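import Summits.CriticalPhenomena.Ising3DConformalLimit.Theorems.EnergyNotSigmaSquaredGapForcesFarMergingScreeningDefs
import Literature.Probability.LatticeModels.CriticalAxisRatioRegularity

/-! # Root opacity from floors — the counting step
(line `screening-form-lemma-a1` of crux `GapForcesFarMerging`, item stmt-CriticalPhenomena-4468;
helper file of stub `stub_rootOpacity`, landed first)

Pure real analysis + filters behind `stub_rootOpacity : OnePinchScreeningDecay → Floors → RootOpacityIO`.
Write `A(r;m) = pinchScreen n r m` (box size `n` large). Along a decay scale `m ∈ [2^{K+3}, 2^{K+4})`
the bulk floor, the octave floors `A(2^{j+1};m) ≥ δ A(2^j;m)` (`j₀ ≤ j < K`) and a ROOT FLOOR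
`A(2^{j₀};m) ≥ η` squeeze the product of the octave ratios `r_j ∈ [δ,1]`:
`δ^N λ^{(K-j₀)-N} η ≤ A(2^K;m) ≤ C m^{-κ}/δ ≤ C' λ^{2K}`, `λ = 2^{-κ/2}`, `N` = number of octaves with a
relative drop `r_j ≤ λ` (`ladder_twoRate_le`); with `λ^{P+1} ≤ δ` this forces `P·N + q ≥ K - j₀`
(`drops_count`, no logarithms: monotonicity of `λ^·`). Doubling windows: the dyadic axis values
`G_j = ⟨σ₀σ_{2^j e₁}⟩_{β_c}` are nonincreasing (log-convexity, `criticalTwoPoint_axis_succ_le`) and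
`≥ c₁4^{-j}` (Simon–Lieb, `criticalTwoPoint_bounds_holds`), so with `θ = 4^{-T}` at most `(J+q')/T` of
the steps `j < J` are bad (`G_{j+1} < θG_j`, `bad_steps_bound`) and an octave without a `θ`-window is
within `3` of a bad step (`card_noWindow_le`). Choosing `T = 14P` leaves an opaque windowed octave
`k ≥ k₀` for every large box size `n`; a pigeonhole over the finite range of `k`
(`exists_frequently_of_eventually_exists`) makes one `k` serve infinitely many `n`; `K → ∞` along the decay
scales gives `∃ᶠ k`. The root floor is a hypothesis at infinitely many root octaves `j₀` (it is needed beyond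
the threshold of the octave floors of `Floors`). References: Aizenman–Duminil-Copin 2021, Def. 5.11 (regular
scales); Simon 1980 / Lieb 1980 (the lower bound); the counting is elementary. -/

noncomputable section

namespace Summit.CriticalPhenomena.Ising3DConformalLimit.EnergyNotSigmaSquaredGapForcesFarMerging

open scoped symmDiff ENNReal
open MeasureTheory Filter Finset
open Literature.Probability.LatticeModels Literature.Probability.Percolation
open Summit.CriticalPhenomena.Ising3DConformalLimit.Theorems.GapForcesFarMerging.Negative (e₁ e₂ cc2 xR up dn)
open Summit.CriticalPhenomena.Ising3DConformalLimit.GapForcesFarMergingScreening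

/-! ### Two-rate ladders: product bound and drop counting -/

/-- Two-rate product bound along a ladder with floors: if `δ·a(i) ≤ a(i+1)` for `i < t` then
`δ^N · λ^{t-N} · a(0) ≤ a(t)`, where `N` is the number of `λ`-drops `a(i+1) ≤ λ·a(i)`, `i < t`
(each step contributes a factor `≥ δ`, each non-drop step a factor `≥ λ`). [folklore] -/
theorem ladder_twoRate_le (a : ℕ → ℝ) {δ lam : ℝ} (hδ : 0 ≤ δ) (hlam : 0 ≤ lam) (t : ℕ)
    (hfloor : ∀ i < t, δ * a i ≤ a (i + 1)) :
    δ ^ #((range t).filter fun i => a (i + 1) ≤ lam * a i) *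
        lam ^ (t - #((range t).filter fun i => a (i + 1) ≤ lam * a i)) * a 0 ≤ a t := by
  induction t with
  | zero => simp
  | succ t ih =>
    have ih' := ih fun i hi => hfloor i (Nat.lt_succ_of_lt hi)
    set N := #((range t).filter fun i => a (i + 1) ≤ lam * a i) with hN
    have hNt : N ≤ t := (card_filter_le _ _).trans (card_range t).le
    have hnot : t ∉ (range t).filter fun i => a (i + 1) ≤ lam * a i := by simp
    rw [range_add_one, filter_insert]
    by_cases hdrop : a (t + 1) ≤ lam * a t
    · rw [if_pos hdrop, card_insert_of_notMem hnot, ← hN,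
        show t + 1 - (N + 1) = t - N by omega, pow_succ]
      calc δ ^ N * δ * lam ^ (t - N) * a 0 = δ * (δ ^ N * lam ^ (t - N) * a 0) := by ring
        _ ≤ δ * a t := mul_le_mul_of_nonneg_left ih' hδ
        _ ≤ a (t + 1) := hfloor t (Nat.lt_succ_self t)
    · rw [if_neg hdrop, ← hN, show t + 1 - N = (t - N) + 1 by omega, pow_succ]
      push Not at hdrop
      calc δ ^ N * (lam ^ (t - N) * lam) * a 0 = lam * (δ ^ N * lam ^ (t - N) * a 0) := by ring
        _ ≤ lam * a t := mul_le_mul_of_nonneg_left ih' hlam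
        _ ≤ a (t + 1) := hdrop.le

/-- Positivity along a ladder with floors from a positive root: `0 < a(0)`, `0 < δ`,
`δ·a(i) ≤ a(i+1)` (`i < t`) give `0 < a(t)`. [folklore] -/
theorem ladder_pos (a : ℕ → ℝ) {δ : ℝ} (hδ : 0 < δ) (h0 : 0 < a 0) (t : ℕ)
    (hfloor : ∀ i < t, δ * a i ≤ a (i + 1)) : 0 < a t := by
  induction t with
  | zero => exact h0
  | succ t ih =>
    exact lt_of_lt_of_le (mul_pos hδ (ih fun i hi => hfloor i (Nat.lt_succ_of_lt hi)))
      (hfloor t (Nat.lt_succ_self t))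

/-- Counting the drops without logarithms: for `0 < λ < 1`, `λ^{P+1} ≤ δ`, `C·λ^q ≤ 1` and `N ≤ t`,
the squeeze `δ^N λ^{t-N} ≤ C λ^{2t}` forces `t ≤ P·N + q`. [folklore] -/
theorem drops_count {δ lam C : ℝ} {P q t N : ℕ} (hlam0 : 0 < lam) (hlam1 : lam < 1)
    (hP : lam ^ (P + 1) ≤ δ) (hq : C * lam ^ q ≤ 1) (hNt : N ≤ t)
    (h : δ ^ N * lam ^ (t - N) ≤ C * lam ^ (2 * t)) : t ≤ P * N + q := by
  have h1 : lam ^ ((P + 1) * N + (t - N)) ≤ C * lam ^ (2 * t) :=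
    calc lam ^ ((P + 1) * N + (t - N)) = (lam ^ (P + 1)) ^ N * lam ^ (t - N) := by
          rw [pow_add, pow_mul]
      _ ≤ δ ^ N * lam ^ (t - N) := by gcongr
      _ ≤ C * lam ^ (2 * t) := h
  by_cases hqt : q ≤ 2 * t
  · have h2 : lam ^ ((P + 1) * N + (t - N)) ≤ lam ^ (2 * t - q) :=
      calc lam ^ ((P + 1) * N + (t - N)) ≤ C * lam ^ (2 * t) := h1
        _ = C * lam ^ q * lam ^ (2 * t - q) := by
            rw [mul_assoc, ← pow_add, Nat.add_sub_cancel' hqt]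
        _ ≤ 1 * lam ^ (2 * t - q) := by gcongr
        _ = lam ^ (2 * t - q) := one_mul _
    have h3 := (pow_le_pow_iff_right_of_lt_one₀ hlam0 hlam1).1 h2
    have h4 : (P + 1) * N = P * N + N := by ring
    omega
  · omega

/-! ### Dyadic axis values of the critical two-point function -/

/-- `2^j • e₁` is the axis site `(2^j) e₁`. [folklore] -/
theorem two_pow_smul_e₁ (j : ℕ) :
    ((2 : ℤ) ^ j) • (e₁ : Site 3) = Pi.single 0 ((2 ^ j : ℕ) : ℤ) := by
  rw [← Pi.single_smul]
  simp

/-- Monotonicity of the critical two-point function along the first axis beyond the first step,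
`⟨σ₀σ_{(b+1+k)e₁}⟩ ≤ ⟨σ₀σ_{(b+1)e₁}⟩` (iterated `criticalTwoPoint_axis_succ_le`, log-convexity).
[cite: AizenmanDuminilCopinAnnals2021, arXiv:1912.07973 §5.5 proof of Prop. 5.9] -/
theorem criticalTwoPoint_axis_add_le (b k : ℕ) :
    criticalTwoPoint 3 (Pi.single 0 ((b + 1 + k : ℕ) : ℤ)) ≤
      criticalTwoPoint 3 (Pi.single 0 ((b + 1 : ℕ) : ℤ)) := by
  induction k with
  | zero => simp
  | succ k ih =>
    have h := criticalTwoPoint_axis_succ_le 0 (b + k)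
    rw [show b + k + 2 = b + 1 + (k + 1) by ring, show b + k + 1 = b + 1 + k by ring] at h
    exact h.trans ih

/-- Dyadic axis monotonicity `⟨σ₀σ_{2^{j+1}e₁}⟩_{β_c} ≤ ⟨σ₀σ_{2^je₁}⟩_{β_c}`.
[cite: AizenmanDuminilCopinAnnals2021, arXiv:1912.07973 §5.5 proof of Prop. 5.9] -/
theorem criticalTwoPoint_dyadic_succ_le (j : ℕ) :
    criticalTwoPoint 3 (((2 : ℤ) ^ (j + 1)) • e₁) ≤ criticalTwoPoint 3 (((2 : ℤ) ^ j) • e₁) := by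
  rw [two_pow_smul_e₁, two_pow_smul_e₁]
  have h := criticalTwoPoint_axis_add_le (2 ^ j - 1) (2 ^ j)
  have h1 : 2 ^ j - 1 + 1 + 2 ^ j = 2 ^ (j + 1) := by
    have := Nat.one_le_two_pow (n := j); rw [pow_succ]; omega
  have h2 : 2 ^ j - 1 + 1 = 2 ^ j := by have := Nat.one_le_two_pow (n := j); omega
  rwa [h1, h2] at h

/-- Simon–Lieb lower bound along the dyadic axis: `c₁·4^{-J} ≤ ⟨σ₀σ_{2^Je₁}⟩_{β_c}` for some `c₁ > 0`
(`criticalTwoPoint_bounds_holds`: `c‖x‖^{-2} ≤ G(x)`, `‖2^Je₁‖ = 2^J`). [cite: FriedliVelenik2017, Thm. 3.17] -/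
theorem exists_dyadic_lower :
    ∃ c₁ : ℝ, 0 < c₁ ∧ ∀ J : ℕ, c₁ * (1 / 4 : ℝ) ^ J ≤ criticalTwoPoint 3 (((2 : ℤ) ^ J) • e₁) := by
  obtain ⟨c, C, hc, hb⟩ := criticalTwoPoint_bounds_holds (d := 3) le_rfl
  refine ⟨c, hc, fun J => ?_⟩
  rw [two_pow_smul_e₁]
  have hne : (Pi.single 0 ((2 ^ J : ℕ) : ℤ) : Site 3) ≠ 0 := by
    intro h
    have := congr_fun h 0
    simp at this
  have h := (hb _ hne).1
  have hnorm : ‖(Pi.single 0 ((2 ^ J : ℕ) : ℤ) : Site 3)‖ = (2 : ℝ) ^ J := by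
    rw [Pi.norm_single, Int.norm_natCast]; push_cast; rfl
  have h3 : (-(((3 : ℕ) : ℝ) - 1)) = -((2 : ℕ) : ℝ) := by norm_num
  rw [hnorm, h3, Real.rpow_neg (by positivity), Real.rpow_natCast, ← pow_mul, pow_mul'] at h
  convert h using 2
  rw [one_div, inv_pow]
  norm_num

/-- Bad dyadic steps are geometric losses: `G_J ≤ θ^{#bad steps below J}` where a step `j` is bad when
`G_{j+1} < θ G_j` (the other steps lose nothing upward since `G_{j+1} ≤ G_j`, and `G_0 ≤ 1`). [folklore] -/
theorem dyadic_le_theta_pow {θ : ℝ} (hθ : 0 ≤ θ) (J : ℕ) :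
    criticalTwoPoint 3 (((2 : ℤ) ^ J) • e₁) ≤
      θ ^ #((range J).filter fun j => criticalTwoPoint 3 (((2 : ℤ) ^ (j + 1)) • e₁) <
        θ * criticalTwoPoint 3 (((2 : ℤ) ^ j) • e₁)) := by
  induction J with
  | zero => simpa using criticalTwoPoint_le_one' (d := 3) e₁
  | succ J ih =>
    have hnot : J ∉ (range J).filter fun j => criticalTwoPoint 3 (((2 : ℤ) ^ (j + 1)) • e₁) <
        θ * criticalTwoPoint 3 (((2 : ℤ) ^ j) • e₁) := by simp
    rw [range_add_one, filter_insert]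
    by_cases hbad : criticalTwoPoint 3 (((2 : ℤ) ^ (J + 1)) • e₁) <
        θ * criticalTwoPoint 3 (((2 : ℤ) ^ J) • e₁)
    · rw [if_pos hbad, card_insert_of_notMem hnot]
      calc criticalTwoPoint 3 (((2 : ℤ) ^ (J + 1)) • e₁)
          ≤ θ * criticalTwoPoint 3 (((2 : ℤ) ^ J) • e₁) := hbad.le
        _ ≤ θ * θ ^ #((range J).filter fun j => criticalTwoPoint 3 (((2 : ℤ) ^ (j + 1)) • e₁) <
              θ * criticalTwoPoint 3 (((2 : ℤ) ^ j) • e₁)) := mul_le_mul_of_nonneg_left ih hθ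
        _ = _ := by rw [pow_succ, mul_comm]
    · rw [if_neg hbad]
      exact (criticalTwoPoint_dyadic_succ_le J).trans ih

/-- Counting bad dyadic steps: with `θ = 4^{-T}` and `4^{-q'} ≤ c₁` (the Simon–Lieb constant),
`T · #{j < J bad} ≤ J + q'`. [folklore] -/
theorem bad_steps_bound {c₁ : ℝ} {q' : ℕ}
    (hc₁ : ∀ J : ℕ, c₁ * (1 / 4 : ℝ) ^ J ≤ criticalTwoPoint 3 (((2 : ℤ) ^ J) • e₁))
    (hq' : (1 / 4 : ℝ) ^ q' ≤ c₁) (T J : ℕ) :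
    T * #((range J).filter fun j => criticalTwoPoint 3 (((2 : ℤ) ^ (j + 1)) • e₁) <
        (1 / 4 : ℝ) ^ T * criticalTwoPoint 3 (((2 : ℤ) ^ j) • e₁)) ≤ J + q' := by
  set b := #((range J).filter fun j => criticalTwoPoint 3 (((2 : ℤ) ^ (j + 1)) • e₁) <
        (1 / 4 : ℝ) ^ T * criticalTwoPoint 3 (((2 : ℤ) ^ j) • e₁))
  have hθ : (0 : ℝ) ≤ (1 / 4) ^ T := by positivity
  have key : (1 / 4 : ℝ) ^ (J + q') ≤ (1 / 4) ^ (T * b) :=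
    calc (1 / 4 : ℝ) ^ (J + q') = (1 / 4) ^ q' * (1 / 4) ^ J := by rw [pow_add, mul_comm]
      _ ≤ c₁ * (1 / 4) ^ J := by gcongr
      _ ≤ criticalTwoPoint 3 (((2 : ℤ) ^ J) • e₁) := hc₁ J
      _ ≤ ((1 / 4 : ℝ) ^ T) ^ b := dyadic_le_theta_pow hθ J
      _ = (1 / 4) ^ (T * b) := by rw [pow_mul]
  exact (pow_le_pow_iff_right_of_lt_one₀ (by norm_num) (by norm_num)).1 key

/-- Octaves without a `θ`-doubling window lie within `3` of a bad step:
`#{k < K : ¬DoublingWindow θ k} ≤ 7 · #{j < K+3 bad}`. [folklore] -/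
theorem card_noWindow_le (θ : ℝ) [DecidablePred fun k => ¬DoublingWindow θ k] (K : ℕ) :
    #((range K).filter fun k => ¬DoublingWindow θ k) ≤
      7 * #((range (K + 3)).filter fun j => criticalTwoPoint 3 (((2 : ℤ) ^ (j + 1)) • e₁) <
        θ * criticalTwoPoint 3 (((2 : ℤ) ^ j) • e₁)) := by
  classical
  set B := (range (K + 3)).filter fun j => criticalTwoPoint 3 (((2 : ℤ) ^ (j + 1)) • e₁) <
        θ * criticalTwoPoint 3 (((2 : ℤ) ^ j) • e₁) with hB
  have hsub : ((range K).filter fun k => ¬DoublingWindow θ k) ⊆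
      B.biUnion fun j => Icc (j - 3) (j + 3) := by
    intro k hk
    rw [mem_filter, mem_range] at hk
    obtain ⟨hkK, hnw⟩ := hk
    simp only [DoublingWindow, not_forall, not_le, exists_prop] at hnw
    obtain ⟨j, hj1, hj2, hlt⟩ := hnw
    rw [mem_biUnion]
    exact ⟨j, mem_filter.2 ⟨mem_range.2 (by omega), hlt⟩, mem_Icc.2 ⟨by omega, by omega⟩⟩
  calc #((range K).filter fun k => ¬DoublingWindow θ k)
      ≤ #(B.biUnion fun j => Icc (j - 3) (j + 3)) := card_le_card hsub
    _ ≤ ∑ j ∈ B, #(Icc (j - 3) (j + 3)) := card_biUnion_le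
    _ ≤ ∑ _j ∈ B, 7 := sum_le_sum fun j _ => by rw [Nat.card_Icc]; omega
    _ = 7 * #B := by rw [sum_const, smul_eq_mul, mul_comm]

/-! ### Pigeonhole along a filter -/

/-- Pigeonhole over a finite index set along `atTop`: if eventually some index in `s` is good, then
one index of `s` is good frequently. [folklore] -/
theorem exists_frequently_of_eventually_exists {ι : Type*} (s : Finset ι) {P : ι → ℕ → Prop}
    (h : ∀ᶠ n in atTop, ∃ i ∈ s, P i n) : ∃ i ∈ s, ∃ᶠ n in atTop, P i n := by
  by_contra hcon
  simp only [not_exists, not_and, Filter.not_frequently] at hcon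
  have hall : ∀ᶠ n in atTop, ∀ i ∈ s, ¬P i n := (Filter.eventually_all_finset s).2 hcon
  obtain ⟨n, ⟨i, hi, hP⟩, hn2⟩ := (h.and hall).exists
  exact hn2 i hi hP

/-! ### The counting theorem -/

/-- **Root opacity from decay, floors and a root floor (the counting behind `stub_rootOpacity`).**
If the one-pinch screening ladder `A(r;m) = pinchScreen n r m` has (i) a ROOT FLOOR `A(2^{j₀};m) ≥ η > 0`
for large `m` and large `n`, at infinitely many root octaves `j₀`; (ii) the decay `A(n;m) ≤ C m^{-κ}` along
infinitely many `m` (`OnePinchScreeningDecay`); (iii) the octave and bulk floors (`Floors`) — then for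
infinitely many octaves `k`, each in a `θ`-doubling window of the critical two-point function, some far scale
`m ≥ 2^{k+3}` carries a relative drop `A(2^{k+1};m) ≤ (1-c)A(2^k;m)` with `A(2^k;m) > 0` for infinitely many
box sizes (`RootOpacityIO`), with `1 - c = 2^{-κ/2}` and `θ = 4^{-14P}`, `2^{-(P+1)κ/2} ≤ δ`. [folklore] -/
theorem rootOpacity_of_floors_rootFloor :
    (∃ᶠ j₀ : ℕ in atTop, ∃ η : ℝ, 0 < η ∧
      ∀ᶠ m : ℕ in atTop, ∀ᶠ n : ℕ in atTop, η ≤ pinchScreen n (2 ^ j₀) m) →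
    OnePinchScreeningDecay → Floors → RootOpacityIO := by
  intro hRoot hDecay hFloors
  classical
  obtain ⟨κ, C, hκ, hfreq⟩ := hDecay
  obtain ⟨δ, hδ, hoct, hbulk⟩ := hFloors
  -- the drop rate `λ = 2^{-κ/2}` (`c = 1 - λ`) and `P` with `λ^{P+1} ≤ δ`
  set lam : ℝ := (2 : ℝ) ^ (-(κ / 2)) with hlam
  have hlam0 : 0 < lam := Real.rpow_pos_of_pos two_pos _
  have hlam1 : lam < 1 := Real.rpow_lt_one_of_one_lt_of_neg one_lt_two (by linarith)
  obtain ⟨P, hP⟩ : ∃ P : ℕ, lam ^ (P + 1) ≤ δ := by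
    obtain ⟨p, hp⟩ := exists_pow_lt_of_lt_one hδ hlam1
    exact ⟨p, (pow_le_pow_of_le_one hlam0.le hlam1.le (Nat.le_succ p)).trans hp.le⟩
  -- the window constants: Simon–Lieb `c₁`, `4^{-q'} ≤ c₁`, `θ = 4^{-T}`, `T = 14P`
  obtain ⟨c₁, hc₁pos, hc₁⟩ := exists_dyadic_lower
  obtain ⟨q', hq'⟩ := exists_pow_lt_of_lt_one hc₁pos (by norm_num : (1 / 4 : ℝ) < 1)
  set T : ℕ := 14 * P with hT
  refine ⟨1 - lam, (1 / 4 : ℝ) ^ T, by linarith, by positivity, ?_⟩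
  -- thresholds: octave floors beyond `j₁`, a root floor at `j₀ ≥ j₁` for `m ≥ m₁`, bulk floors beyond `k₁`
  obtain ⟨j₁, hj₁⟩ := Filter.eventually_atTop.1 hoct
  obtain ⟨j₀, hj₀, η, hη, hroot⟩ := hRoot.forall_exists_of_atTop j₁
  obtain ⟨m₁, hm₁⟩ := Filter.eventually_atTop.1 hroot
  obtain ⟨k₁, hk₁⟩ := Filter.eventually_atTop.1 hbulk
  -- `C₂ λ^q ≤ 1`, `C₂ = max C 1 / (δ η)`
  set C₂ : ℝ := max C 1 / (δ * η) with hC₂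
  have hC₂pos : 0 < C₂ := by positivity
  obtain ⟨q, hq⟩ : ∃ q : ℕ, C₂ * lam ^ q ≤ 1 := by
    obtain ⟨q, hq⟩ := exists_pow_lt_of_lt_one (inv_pos.2 hC₂pos) hlam1
    exact ⟨q, (mul_le_mul_of_nonneg_left hq.le hC₂pos.le).trans_eq (mul_inv_cancel₀ hC₂pos.ne')⟩
  refine Filter.frequently_atTop.2 fun k₀ => ?_
  -- a decay scale `m ∈ [2^{K+3}, 2^{K+4})` with `K ≥ K₀`
  set K₀ : ℕ := 2 * j₀ + 2 * q + 2 * (P * k₀) + q' + k₁ + 4 with hK₀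
  obtain ⟨m, hmge, hm⟩ := hfreq.forall_exists_of_atTop (max (2 ^ (K₀ + 3)) m₁)
  have hm2 : 2 ^ (K₀ + 3) ≤ m := le_of_max_le_left hmge
  have hmm₁ : m₁ ≤ m := le_of_max_le_right hmge
  have hm0 : m ≠ 0 := by have := Nat.one_le_two_pow (n := K₀ + 3); omega
  obtain ⟨K, hK⟩ : ∃ K : ℕ, K = Nat.log 2 m - 3 := ⟨_, rfl⟩
  have hlogK₀ : K₀ + 3 ≤ Nat.log 2 m := Nat.le_log_of_pow_le one_lt_two hm2
  have hmK : 2 ^ (K + 3) ≤ m := (show K + 3 = Nat.log 2 m by omega) ▸ Nat.pow_log_le_self 2 hm0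
  have hmK' : m < 2 ^ (K + 4) :=
    (show Nat.log 2 m + 1 = K + 4 by omega) ▸ Nat.lt_pow_succ_log_self one_lt_two m
  have hK₀K : K₀ ≤ K := by omega
  -- the large box sizes: decay at `m`, bulk floor at `(K,m)`, octave floors on `[j₀,K)`, root floor at `j₀`
  have hE : ∀ᶠ n : ℕ in atTop, pinchScreen n n m ≤ C * (m : ℝ) ^ (-κ) ∧
      δ * pinchScreen n (2 ^ K) m ≤ pinchScreen n n m ∧
      (∀ j ∈ Ico j₀ K, δ * pinchScreen n (2 ^ j) m ≤ pinchScreen n (2 ^ (j + 1)) m) ∧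
      η ≤ pinchScreen n (2 ^ j₀) m := by
    refine hm.and ((hk₁ K (by omega) m hmK hmK').and
      (((Filter.eventually_all_finset _).2 fun j hj => ?_).and (hm₁ m hmm₁)))
    rw [mem_Ico] at hj
    refine hj₁ j (by omega) m ?_
    calc 2 ^ (j + 4) ≤ 2 ^ (K + 3) := Nat.pow_le_pow_right (by norm_num) (by omega)
      _ ≤ m := hmK
  -- for each such `n`: an opaque, windowed octave `k ∈ [j₀, K)` with `k ≥ k₀`
  have hstep : ∀ᶠ n : ℕ in atTop, ∃ k ∈ Ico j₀ K, k₀ ≤ k ∧ DoublingWindow ((1 / 4 : ℝ) ^ T) k ∧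
      0 < pinchScreen n (2 ^ k) m ∧
      pinchScreen n (2 ^ (k + 1)) m ≤ lam * pinchScreen n (2 ^ k) m := by
    filter_upwards [hE] with n hn
    obtain ⟨hdec, hblk, hoctn, hrt⟩ := hn
    -- the ladder `a i = A(2^{j₀+i}; m)`, `i ≤ t = K - j₀`
    obtain ⟨a, ha⟩ : ∃ a : ℕ → ℝ, ∀ i, a i = pinchScreen n (2 ^ (j₀ + i)) m := ⟨_, fun _ => rfl⟩
    obtain ⟨t, ht⟩ : ∃ t : ℕ, t = K - j₀ := ⟨_, rfl⟩
    have hfl : ∀ i < t, δ * a i ≤ a (i + 1) := fun i hi => by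
      rw [ha, ha]
      exact hoctn (j₀ + i) (mem_Ico.2 ⟨by omega, by omega⟩)
    have ha0 : 0 < a 0 := by rw [ha]; exact lt_of_lt_of_le hη hrt
    have hpos : ∀ i ≤ t, 0 < a i := fun i hi =>
      ladder_pos a hδ ha0 i fun i' hi' => hfl i' (by omega)
    have hlow := ladder_twoRate_le a hδ.le hlam0.le t hfl
    set N := #((range t).filter fun i => a (i + 1) ≤ lam * a i) with hN
    have hNt : N ≤ t := (card_filter_le _ _).trans (card_range t).le
    have hat : a t = pinchScreen n (2 ^ K) m := by
      rw [ha, show j₀ + t = K by omega]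
    -- the squeeze `δ^N λ^{t-N} ≤ C₂ λ^{2t}`
    have hdecay' : pinchScreen n n m ≤ max C 1 * lam ^ (2 * (K + 3)) := by
      have h1 : (m : ℝ) ^ (-κ) ≤ ((2 : ℝ) ^ (K + 3)) ^ (-κ) :=
        Real.rpow_le_rpow_of_nonpos (by positivity) (by exact_mod_cast hmK) (by linarith)
      have h2 : ((2 : ℝ) ^ (K + 3)) ^ (-κ) = lam ^ (2 * (K + 3)) := by
        rw [hlam, ← Real.rpow_natCast (2 : ℝ) (K + 3), ← Real.rpow_mul (by norm_num : (0 : ℝ) ≤ 2),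
          ← Real.rpow_natCast ((2 : ℝ) ^ (-(κ / 2))) (2 * (K + 3)),
          ← Real.rpow_mul (by norm_num : (0 : ℝ) ≤ 2)]
        congr 1; push_cast; ring
      calc pinchScreen n n m ≤ C * (m : ℝ) ^ (-κ) := hdec
        _ ≤ max C 1 * (m : ℝ) ^ (-κ) := mul_le_mul_of_nonneg_right (le_max_left _ _) (by positivity)
        _ ≤ max C 1 * ((2 : ℝ) ^ (K + 3)) ^ (-κ) := mul_le_mul_of_nonneg_left h1 (by positivity)
        _ = max C 1 * lam ^ (2 * (K + 3)) := by rw [h2]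
    have hsq : δ ^ N * lam ^ (t - N) ≤ C₂ * lam ^ (2 * t) := by
      have h1 : δ ^ N * lam ^ (t - N) * η ≤ a t :=
        (mul_le_mul_of_nonneg_left (hrt.trans_eq (ha 0).symm) (by positivity)).trans hlow
      have h2 : δ * a t ≤ max C 1 * lam ^ (2 * t) := by
        rw [hat]
        calc δ * pinchScreen n (2 ^ K) m ≤ pinchScreen n n m := hblk
          _ ≤ max C 1 * lam ^ (2 * (K + 3)) := hdecay'
          _ ≤ max C 1 * lam ^ (2 * t) :=
            mul_le_mul_of_nonneg_left (pow_le_pow_of_le_one hlam0.le hlam1.le (by omega))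
              (by positivity)
      rw [hC₂, div_mul_eq_mul_div, le_div_iff₀ (by positivity)]
      calc δ ^ N * lam ^ (t - N) * (δ * η) = δ * (δ ^ N * lam ^ (t - N) * η) := by ring
        _ ≤ δ * a t := mul_le_mul_of_nonneg_left h1 hδ.le
        _ ≤ max C 1 * lam ^ (2 * t) := h2
    have hcount : t ≤ P * N + q := drops_count hlam0 hlam1 hP hq hNt hsq
    -- windows: few bad steps, few octaves without a window
    have hbad := bad_steps_bound hc₁ hq'.le T (K + 3)
    have hwin := card_noWindow_le ((1 / 4 : ℝ) ^ T) K
    set b := #((range (K + 3)).filter fun j => criticalTwoPoint 3 (((2 : ℤ) ^ (j + 1)) • e₁) <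
        (1 / 4 : ℝ) ^ T * criticalTwoPoint 3 (((2 : ℤ) ^ j) • e₁)) with hb
    -- the excluded indices `i < t`: `j₀ + i < k₀`, or no window at `j₀ + i`
    set X := (range t).filter fun i => j₀ + i < k₀ ∨ ¬DoublingWindow ((1 / 4 : ℝ) ^ T) (j₀ + i)
      with hX
    have hXcard : #X ≤ k₀ + 7 * b := by
      have hX1 : #((range t).filter fun i => j₀ + i < k₀) ≤ k₀ :=
        calc #((range t).filter fun i => j₀ + i < k₀) ≤ #(range k₀) :=
              card_le_card_of_injOn (fun i => j₀ + i)
                (fun i hi => by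
                  simp only [Finset.mem_coe, mem_filter, mem_range] at hi ⊢
                  omega)
                (fun i _ i' _ h => Nat.add_left_cancel h)
          _ = k₀ := card_range k₀
      have hX2 : #((range t).filter fun i => ¬DoublingWindow ((1 / 4 : ℝ) ^ T) (j₀ + i)) ≤
          #((range K).filter fun k => ¬DoublingWindow ((1 / 4 : ℝ) ^ T) k) :=
        card_le_card_of_injOn (fun i => j₀ + i)
          (fun i hi => by
            simp only [Finset.mem_coe, mem_filter, mem_range] at hi ⊢
            exact ⟨by omega, hi.2⟩)
          (fun i _ i' _ h => Nat.add_left_cancel h)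
      calc #X ≤ #((range t).filter fun i => j₀ + i < k₀) +
            #((range t).filter fun i => ¬DoublingWindow ((1 / 4 : ℝ) ^ T) (j₀ + i)) := by
            rw [hX, filter_or]; exact card_union_le _ _
        _ ≤ k₀ + 7 * b := add_le_add hX1 (hX2.trans hwin)
    -- counting: more drops than excluded indices
    have hNX : #X < N := by
      by_contra hle
      push Not at hle
      have h1 : P * N ≤ P * k₀ + 7 * (P * b) :=
        calc P * N ≤ P * (k₀ + 7 * b) := Nat.mul_le_mul_left P (hle.trans hXcard)
          _ = P * k₀ + 7 * (P * b) := by ring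
      have h2 : 14 * (P * b) ≤ K + 3 + q' := by simpa only [hT, mul_assoc] using hbad
      omega
    obtain ⟨i, hiD, hiX⟩ := exists_mem_notMem_of_card_lt_card hNX
    rw [mem_filter, mem_range] at hiD
    have hiX' : ¬(j₀ + i < k₀ ∨ ¬DoublingWindow ((1 / 4 : ℝ) ^ T) (j₀ + i)) := fun h =>
      hiX (mem_filter.2 ⟨mem_range.2 hiD.1, h⟩)
    push Not at hiX'
    refine ⟨j₀ + i, mem_Ico.2 ⟨by omega, by omega⟩, hiX'.1, hiX'.2, ?_, ?_⟩
    · rw [← ha]; exact hpos i hiD.1.le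
    · have h := hiD.2; rw [ha, ha] at h; exact h
  -- pigeonhole over `k ∈ [j₀, K)`, then read off `RootOpacityIO` at this `k` and `m`
  obtain ⟨k, hk, hfr⟩ := exists_frequently_of_eventually_exists _ hstep
  obtain ⟨-, hkk₀, hkw, -, -⟩ := hfr.exists
  rw [mem_Ico] at hk
  refine ⟨k, hkk₀, hkw, m, ?_, hfr.mono fun n hn => ⟨hn.2.2.1, ?_⟩⟩
  · calc 2 ^ (k + 3) ≤ 2 ^ (K + 3) := Nat.pow_le_pow_right (by norm_num) (by omega)
      _ ≤ m := hmK
  · rw [sub_sub_cancel]; exact hn.2.2.2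

end Summit.CriticalPhenomena.Ising3DConformalLimit.EnergyNotSigmaSquaredGapForcesFarMerging

end
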